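import Mathlib
import HarnessLib
import Summits.KontsevichZagierPeriods.Zeta5Search.Denom.TwoTaleP15Forms
import Summits.KontsevichZagierPeriods.Zeta5Search.Denom.TwoTaleL25Forms
import Summits.KontsevichZagierPeriods.Zeta5Search.Denom.TwoTaleL25Saving

/-!
# Rung L(2/5) — the inclusion input and the CONDITIONAL measure `μ(ζ(2)) ≤ 1 + (C₁ + 76 − S)/(c − 76 + S)`

HONEST FRAMING: systematic search; no irrationality claim unless certified.  This file claims NO measure of `ζ(2)`: it is
the second half of the L(2/5) twin of `Denom/TwoTaleD1Forms` (F2 of the D1 programme), split off so that the head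
`Denom/TwoTaleL25Forms` does not depend on the saving file.  At the ladder point `a = (32n+1, 27n+1, 22n+1, 37n+1)`,
`b = (1, 5n+1, 10n+1, 64n+2)` of [Zudilin2014ZetaTwo, §3] (rung `s = 2/5`, normaliser `D₃₇ₙ D₃₉ₙ`, joint saving
`Φₙ = savingProductL25 n` with certified rate `S = savingRateL25 ∈ [39.27798, 39.27811]`, `Denom/TwoTaleL25Saving`) it
NAMES the inclusion input
* `InclusionL25` — `Φₙ ∣ D₃₇ₙD₃₉ₙ qₙ` and `Φₙ⁻¹ D₃₇ₙD₃₉ₙ pₙ ∈ ℤ` for `n ≥ 1` (DISCHARGED by `TwoTaleL25Inclusion`: Lemma 7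
  cells + Lemma 8 cells through the two-tale identity (bmiss) `q = −q̂, p = −p̂` = the tree's `TwoTaleOmega.bmiss_Lad`
  at `Lad(5n, 2n)`),
and PROVES the implication from the named inputs to the measure:
* **`exponentLE_of_inputsL25`**: `InclusionL25 → DecayL25 c → CoeffRateL25 C₁ → 76 − S < c → 0 < C₁ →
  ExponentLE (ζ(2)) (1 + (C₁ + (76 − S))/(c − (76 − S)))`, via the tree's abstract
  `TwoTaleP15Forms.exponentLE_of_normalisedForms` and `irrational_zetaValue_two`;
* **`zetaTwo_exponent_le_L25_of_inputs`**: `InclusionL25 → DecayL25 71.44179 → CoeffRateL25 C₁ → 0 < C₁ → C₁ ≤ 102.84495 →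
  ExponentLE (ζ(2)) 5.01982` (kernel arithmetic: `1 + (102.84495 + 76 − 39.27798)/(71.44179 − 76 + 39.27798) = 5.019814… ≤
  5.01982`; design value `5.01980532`, fam-measure g8 `rung_cost.log`).
AN IMPLICATION ONLY; the inputs are the successors' theorems (`TwoTaleL25Inclusion`, `TwoTaleL25Decay`,
`TwoTaleL25GrowthLimit` / `TwoTaleL25GrowthEnclosure`) and the capstone is `TwoTaleL25Measure`.  Nothing about `ζ(5)`.
-/

noncomputable section

open Filter Topology Finset
open Literature.NumberTheory.Transcendental
open Literature.NumberTheory.Irrationality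
open Literature.NumberTheory.Irrationality.Zudilin2014
open Summit.KontsevichZagierPeriods.Zeta5Search.Denom.TwoTaleL25Saving
open Summit.KontsevichZagierPeriods.Zeta5Search.Denom.TwoTaleL25Forms

namespace Summit.KontsevichZagierPeriods.Zeta5Search.Denom.TwoTaleL25Exponent

/-! ### The inclusion input -/

/-- **INPUT — inclusion** (Lemma 7 ∪ Lemma 8 ∪ (bmiss) at the point): `Φₙ ∣ D₃₇ₙD₃₉ₙ qₙ` and `Φₙ⁻¹ D₃₇ₙD₃₉ₙ pₙ ∈ ℤ`
for `n ≥ 1`, `Φₙ = savingProductL25 n` (primes `80√n < p ≤ 37n`, digit `ν = max(φ, φ̂)`).  Discharged by the successor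
`TwoTaleL25Inclusion`; an input here. -/
@[conjecture] def InclusionL25 : Prop :=
  ∀ n : ℕ, 1 ≤ n →
    (∃ B : ℤ, ((lcmNormaliserL25 n : ℕ) : ℤ) * formQL25 n = (savingProductL25 n : ℤ) * B) ∧
      ∃ A : ℤ, ((lcmNormaliserL25 n : ℕ) : ℚ) * formPL25 n = (savingProductL25 n : ℚ) * A

/-! ### The conditional measure (PROVED implication) -/

/-- The normaliser rate: `(1/n) log (D₃₇ₙD₃₉ₙ/Φₙ) → 76 − S` (`TwoTaleL25Saving.tendsto_log_lcmNormaliserL25_div`). -/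
theorem tendsto_log_lcmNormaliserL25_div_savingProductL25 :
    Tendsto (fun n : ℕ => Real.log ((lcmNormaliserL25 n : ℝ) / savingProductL25 n) / n) atTop
      (𝓝 (76 - savingRateL25)) := by
  refine tendsto_log_lcmNormaliserL25_div.congr fun n => ?_
  simp only [lcmNormaliserL25, Nat.cast_mul]

/-- **The measure at rung L(2/5) from the three inputs (PROVED implication)**, `S = savingRateL25`:
`μ(ζ(2)) ≤ 1 + (C₁ + (76 − S))/(c − (76 − S))` in the `ExponentLE` sense. -/
theorem exponentLE_of_inputsL25 {c C₁ : ℝ} (hI : InclusionL25) (hD : DecayL25 c) (hC : CoeffRateL25 C₁)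
    (hc : 76 - savingRateL25 < c) (hC₀ : 0 < C₁) :
    ExponentLE (zetaValue 2) (1 + (C₁ + (76 - savingRateL25)) / (c - (76 - savingRateL25))) := by
  choose! B hB using fun n (hn : 1 ≤ n) => (hI n hn).1
  choose! A hA using fun n (hn : 1 ≤ n) => (hI n hn).2
  have hS := savingRateL25_lt
  exact Denom.TwoTaleP15Forms.exponentLE_of_normalisedForms Denom.TwoTaleP15Forms.irrational_zetaValue_two
    lcmNormaliserL25_pos savingProductL25_pos hB hA hD hC tendsto_log_lcmNormaliserL25_div_savingProductL25 hc hC₀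
    (by linarith)

/-- **Rung L(2/5), numerically (PROVED implication; the inputs are the successors' theorems, not this file's):**
`c = 71.44179` (`< C₀ = 71.44179775`), `0 < C₁ ≤ 102.84495` and the certified `S ≥ 39.27798` give **`μ(ζ(2)) ≤ 5.01982`**
(design value `5.01980532…`; kernel bound `5.019814`). -/
theorem zetaTwo_exponent_le_L25_of_inputs {C₁ : ℝ} (hI : InclusionL25) (hD : DecayL25 71.44179)
    (hC : CoeffRateL25 C₁) (hC₀ : 0 < C₁) (hC₁ : C₁ ≤ 102.84495) : ExponentLE (zetaValue 2) 5.01982 := by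
  have hS := savingRateL25_bounds
  have h := exponentLE_of_inputsL25 hI hD hC (by linarith [hS.1]) hC₀
  have hden : 0 < 71.44179 - (76 - savingRateL25) := by linarith [hS.1]
  have hle : 1 + (C₁ + (76 - savingRateL25)) / (71.44179 - (76 - savingRateL25)) ≤ 5.01982 := by
    have h1 : (C₁ + (76 - savingRateL25)) / (71.44179 - (76 - savingRateL25)) ≤ 4.01982 := by
      rw [div_le_iff₀ hden]
      linarith [hS.1]
    linarith
  exact h.mono hle

/-- **Loose-constant variant** (margins for the inputs): `c = 71.4`, `0 < C₁ ≤ 102.9` give `μ(ζ(2)) ≤ 5.028`. -/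
theorem zetaTwo_exponent_le_L25_loose {C₁ : ℝ} (hI : InclusionL25) (hD : DecayL25 71.4) (hC : CoeffRateL25 C₁)
    (hC₀ : 0 < C₁) (hC₁ : C₁ ≤ 102.9) : ExponentLE (zetaValue 2) 5.028 := by
  have hS := savingRateL25_bounds
  have h := exponentLE_of_inputsL25 hI hD hC (by linarith [hS.1]) hC₀
  have hden : 0 < 71.4 - (76 - savingRateL25) := by linarith [hS.1]
  have hle : 1 + (C₁ + (76 - savingRateL25)) / (71.4 - (76 - savingRateL25)) ≤ 5.028 := by
    have h1 : (C₁ + (76 - savingRateL25)) / (71.4 - (76 - savingRateL25)) ≤ 4.028 := by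
      rw [div_le_iff₀ hden]
      linarith [hS.1]
    linarith
  exact h.mono hle

end Summit.KontsevichZagierPeriods.Zeta5Search.Denom.TwoTaleL25Exponent

end
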